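import Summits.CriticalPhenomena.PercolationContinuityZ3.Theorems.Transplant.PlanarSkeletonFrmFromDefs
import Summits.CriticalPhenomena.PercolationContinuityZ3.Theorems.Transplant.SkelFrmFrom1ChoiceDefs
import Summits.CriticalPhenomena.PercolationContinuityZ3.Theorems.Transplant.SkelFrm1ChoiceDefs
import Summits.CriticalPhenomena.PercolationContinuityZ3.Theorems.Transplant.SkelFrmFrom1ClosureL
import Summits.CriticalPhenomena.PercolationContinuityZ3.Theorems.Transplant.SkelFrm1ClosureL
import HarnessLib
import Summits.CriticalPhenomena.PercolationContinuityZ3.Theorems.Transplant.SkelFrm1ChoiceL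
/-!
# U-WAVE PORT (RULING D-U, lead g21 2026-08-26; WAVE-U-MANIFEST v3.0 row «SkelFrm1ChoiceL» ↦ «SkelFrmFrom1ChoiceL») of the tree module
# `Transplant/SkelFrm1ChoiceL` onto the carrier `PlanarSkeletonFrmFrom` (frames only, cylinders connected from width `ℓ₀` on)

ORIGINAL TITLE: N2 (the frames-only node `SamePDropOfSkeletonFrm₁`, OPEN), WAVE 0 (c2) file 4b: THE FACE AND CORRIDOR OBLIGATIONS OF A CHOICE AND THE CLOSURE OF RECORD FROM A CHOICE

builds on p205010 (kernel theorem, internal audit signed; external expert review pending) — nothing in this file uses p205010; NOTHING is claimed about the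
OPEN node U `SamePDropOfSkeletonFrmFrom₁` (nor U_s / the end state).  Lane `prim-bschramm`, seat `prim-bschramm-p3` gen 26; helper file
(`--supports stmt-CriticalPhenomena-4575 --as helper`).  PORT RULES r1–r4 of RULING D-U: declaration order and proof texts are those of the original,
byte-identical except (i) the carrier token `PlanarSkeletonFrm ↦ PlanarSkeletonFrmFrom` (binders, `namespace`/`end` lines, qualified names of twinned
declarations), (ii) carrier-FREE declarations of the original (φ-level `Skelφ…` blocks and namespace-only arithmetic residents) are NOT re-declared —
this file imports the original and `export`s the twin-free residents (POLICY T / treatment (m1)); residents whose statement mentions a twinned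
constant are copied, (iii) every carrier-binding declaration keeps its explicit binder `(Φ : PlanarSkeletonFrmFrom G)` in its own signature (r2).  Docstrings and citations are the original's.
-/

noncomputable section

open MeasureTheory ProbabilityTheory
open scoped ENNReal Classical

namespace Summit.CriticalPhenomena.PercolationContinuityZ3.Theorems.Transplant

open Literature.Probability.Percolation Literature.Probability.LatticeModels SimpleGraph KNCells KNLevels
open Literature.Barriers.CriticalPhenomena (HasExponentialGrowth)
open GadgetSystem (tgt)
open SkelConc (Consts)

namespace PlanarSkeletonFrmFrom

variable {V : Type} [DecidableEq V] [Countable V] {G : SimpleGraph V} [G.LocallyFinite]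

namespace ChoiceNQ

variable {κ : Consts} {Φ : PlanarSkeletonFrmFrom G} {t : V} {p : unitInterval} {hC : Φ.CylSubcritical p}

/-- **The face residue, oriented, window map per face, (S0) kits** ((F) column). [this work] -/
def FaceHoldsRNQ (𝒞 : ChoiceNQ κ Φ t p hC) : Prop :=
  ∀ (O : Skelφ.StepI.OutNS V) (q : unitInterval), 𝒞.AtQNQ O q → Skelφ.FaceOblRMOF G (𝒞.scheme O q) (𝒞.FD O q) Φ.Δ κ.δ₂

/-- **The corridor residue, oriented, LENGTH-BUDGETED at the flat root accuracy** ((C) column, K-G corridor): for SOME `nmax ≤ Lf κ.K₀`. [this work] -/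
def ReachHoldsRHNQL (Lf : ℕ → ℕ) (𝒞 : ChoiceNQ κ Φ t p hC) : Prop :=
  ∀ (O : Skelφ.StepI.OutNS V) (q : unitInterval), 𝒞.AtQNQ O q →
    ∃ nmax : ℕ, nmax ≤ Lf κ.K₀ ∧ Skel.ReachOblRHNOF G nmax (𝒞.scheme O q) (𝒞.FD O q) Φ.Δ (κ.δr 0)

end ChoiceNQ

/-- The face obligation of an N2 choice function GIVEN the flat root table and the face inner-chain fact. [this work] -/
def FaceHoldsRNQFnL (Lf : ℕ → ℕ) (𝒞₀ : ChoiceFnNQ) : Prop :=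
  ∀ (κ : Consts) {V : Type} [DecidableEq V] [Countable V] (G : SimpleGraph V) [G.LocallyFinite] (Φ : PlanarSkeletonFrmFrom G)
    (hg : ¬ HasExponentialGrowth G) (t : V) (ht : t ∈ Φ.types) (h1 : Φ.types = {t}) (p : unitInterval) (hp0 : 0 < (p : ℝ)) (hp1 : (p : ℝ) < 1)
    (hC : Φ.CylSubcritical p), FlatQ Lf κ → ChainFactQ Lf G Φ.Δ κ → (𝒞₀ κ G Φ hg t ht h1 p hp0 hp1 hC).FaceHoldsRNQ

/-- The budgeted corridor obligation of an N2 choice function. [this work] -/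
def ReachHoldsRHNQFnL (Lf : ℕ → ℕ) (𝒞₀ : ChoiceFnNQ) : Prop :=
  ∀ (κ : Consts) {V : Type} [DecidableEq V] [Countable V] (G : SimpleGraph V) [G.LocallyFinite] (Φ : PlanarSkeletonFrmFrom G)
    (hg : ¬ HasExponentialGrowth G) (t : V) (ht : t ∈ Φ.types) (h1 : Φ.types = {t}) (p : unitInterval) (hp0 : 0 < (p : ℝ)) (hp1 : (p : ℝ) < 1)
    (hC : Φ.CylSubcritical p), (𝒞₀ κ G Φ hg t ht h1 p hp0 hp1 hC).ReachHoldsRHNQL Lf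

/-- **THE N2 PARTIAL CLOSURE OF RECORD, shared-choice form** (twin of `samePDropOfSkeletonNeg₁_of_choiceFnNOWL`, SkelNeg1ChoiceL :103, over
`samePDropOfSkeletonFrm₁_of_residuesNQL`): an N2 choice function meeting the geometric obligation, the forward law-carrying root obligation given flatness, the face obligation
given flatness and the inner-chain fact, and the budgeted corridor obligation gives `SamePDropOfSkeletonFrm₁`. [cite: KozmaNitzan2024, §4 Theorem 6 (pp. 25–31); §1 p. 2] -/
theorem samePDropOfSkeletonFrmFrom₁_of_choiceFnNQL (Lf : ℕ → ℕ)
    (𝒞₀ : ChoiceFnNQ) (hGm : GeomHoldsNQFn 𝒞₀) (hR : RootHoldsNQWFnL Lf 𝒞₀)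
    (hF : FaceHoldsRNQFnL Lf 𝒞₀) (hRe : ReachHoldsRHNQFnL Lf 𝒞₀) : SamePDropOfSkeletonFrmFrom₁ := by
  refine samePDropOfSkeletonFrmFrom₁_of_residuesNQL Lf
    fun K₀ δ δ₂ δr hδ0 hδ1 hδ₂0 hδ₂1 hδr hflat {V} _ _ G _ Φ hg t ht h1 p hp0 hp1 _ hC _ hCF => ?_
  set κ : Consts := ⟨K₀, δ, δ₂, δr, hδ0, hδ1, hδ₂0, hδ₂1, hδr⟩ with hκ
  have hflat' : FlatQ Lf κ := hflat
  have hCF' : ChainFactQ Lf G Φ.Δ κ := hCF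
  set 𝒞 := 𝒞₀ κ G Φ hg t ht h1 p hp0 hp1 hC with h𝒞
  refine ⟨𝒞.δI, 𝒞.m₀, 𝒞.δI_pos, 𝒞.δI_lt_one, fun O hfacts => ?_⟩
  obtain ⟨hSz, hSMn⟩ := 𝒞.S_adm O hfacts
  refine ⟨𝒞.Sz O, 𝒞.SMn O, hSz, hSMn, fun q hq1 hq2 hin hCq => ?_⟩
  have hat : 𝒞.AtQNQ O q := ⟨hfacts, hq1, hq2, hin, hCq⟩
  obtain ⟨hroot, hK, hrun, hanch, hsep, hexit, hsteps, hlev⟩ := hGm κ G Φ hg t ht h1 p hp0 hp1 hC O q hat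
  obtain ⟨nmax, hnmax, hreach⟩ := hRe κ G Φ hg t ht h1 p hp0 hp1 hC O q hat
  exact ⟨𝒞.Γ O q, 𝒞.FD O q, 𝒞.LD O q, hroot, hK, hrun, hanch, hsep, hexit, hsteps, hlev,
    hR κ G Φ hg t ht h1 p hp0 hp1 hC hflat' O q hat, hF κ G Φ hg t ht h1 p hp0 hp1 hC hflat' hCF' O q hat, nmax, hnmax, hreach⟩

end PlanarSkeletonFrmFrom

end Summit.CriticalPhenomena.PercolationContinuityZ3.Theorems.Transplant

end
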